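import Summits.QuantumFields.YangMills.Theorems.BalabanUVNodesSpineRates
import HarnessLib

/-!
# Route «BalabanUVNodes», cluster K4 «SpineRates» — node N16 = NE3: THE COVARIANT ROOT WITH ITS (Lip₂′ᶜ) CONJUNCT AT A HÖLDER EXPONENT `β`, NAMED
# (`CovRootHolder`), its β-analogue of the venue decl `N16At` (`N16HolderAt`) and of the stub `S_N16` (`S_N16Holder`); `β = 1` IS the root of record

Cell `pub-ymgap`, seat `pub-ymgap-dag-n16-c` (R134 fan-out seat, strategy s1; HUMAN RULING D-0062; chair R424 venue), generation 3, file 11 — the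
DEFINITIONS of the producer column of repair R-β of the located item «the Hölder-exponent pin of N16's N05-socket»
(`HOME/pub-ymgap-dag-n16-c/LOCATED-N16-HOLDER-PIN.md`; pub-ymgap INBOX DAGN16C-G2-LOCATED-1∕-1b∕-1c, DAGN16C-G3-INTENT-1).  `--supports
stmt-QuantumFields-19908` (definition lane).  `bears_on: R4∕N16 · edge N05 → N16 · out-edge N16 → N19`.

WHY.  N16's statement of record `YMDAG.UVSplit.N16At c = NE3EnergyRateWCov 4 (sfClass 4 c.L c.Nper c.ε) c.L c.Nper c.b c.g c.C c.Λ₁ c.Λ₂' c.dom` carries,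
as its third covariant conjunct (Lip₂′ᶜ), «second transported covariant differences of `Z` are `≤ Λ₂′·ξ³`», `ξ = (L⁻¹)^k` — the nearest-neighbour reading of
the (1.36) Hölder member of [Balaban1985RegularSpaces] Thm 2∕4 at exponent `β₀ = 1`, which print EXCLUDES («β ≦ β₀ < 1», p. 82; p. 83 «such information is
unavailable for the second order derivatives»).  The located repair R-β re-words that conjunct at `ξ^{2+β}` for a printed exponent `β` (the NE7 consumers survive
verbatim for `β > 2∕3`: `Thm/BalabanUVNodesN16HolderWindow`).  Generation 2 landed THE END at exponent `β` (`Thm/BalabanUVNodesN16HolderEnd`,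
`…N16HolderEndSfClass`) with the β-root written INLINE (twelve displayed lines per statement).  THIS FILE names it ONCE — `CovRootHolder d 𝒞 L N b g C Λ₁ Λ₂' β dom`
— so that the `1 ↦ β` twins of the N16 producer column (files 12–14 of this seat: `…N16HolderConst`, `…N16HolderOfThm4Output`, `…N16HolderOfLeaf`) conclude
by name, and records the bookkeeping every consumer needs: `β = 1` is LITERALLY the root of record (`covRootHolder_one_iff`), the root of record implies every
β-root with `β ≤ 1` (`covRootHolder_of_ne3EnergyRateWCov` — R-β is a WEAKENING), monotonicity in the constants and in the exponent.

WHAT THIS FILE DECLARES (3 `def`s — hypothesis∕target SHAPES asserted for nothing — and their `Iff.rfl`∕bookkeeping api; 0 `sorry`):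
§1 `CovRootHolder` (the β-root) · `covRootHolder_iff` · `CovRootHolder.perPair` · `CovRootHolder.mono` · `CovRootHolder.of_exponent_le` · `ne3EnergyRateW_of_covRootHolder`;
§2 `covRootHolder_one_iff` (β = 1 ↔ `NE3EnergyRateWCov`) · `covRootHolder_of_ne3EnergyRateWCov` (`β ≤ 1`, `0 ≤ Λ₂′`);
§3 `N16HolderAt c β` (the β-analogue of the venue decl `N16At`; a CANDIDATE wording for the planner — `N16At` is NOT edited) · `n16HolderAt_iff` ·
   `n16HolderAt_one_iff` · `n16HolderAt_of_n16At`; `S_N16Holder β RRec` (the β-analogue of `S_N16`) · `s_N16Holder_iff` · `s_N16Holder_one_iff` · `s_N16Holder_of_s_N16`.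
HONEST FRAMING: definitions and `Iff.rfl`-level bookkeeping; nothing of Bałaban's asserted or proved; the repair's STATEMENT EDIT (R-β ∕ R-Δ ∕ R-min) is the
planner's ∕ director's and is NOT made here; N16 ∕ NE3 NOT discharged; count-neutral; one finite four-torus at fixed ε — NOT ℝ⁴, NOT infinite volume, NOT OS,
NOT a mass gap, NOT Clay.
-/

set_option autoImplicit false

open scoped BigOperators Matrix Matrix.Norms.L2Operator

namespace Summit.QuantumFields.YangMills.BalabanUVNodes.N16HolderDefs

open Literature.MathematicalPhysics.QuantumFieldTheory.Balaban1983to89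
open B7Prop1Explicit B7Prop2Explicit
open T4AveragingDeficitWall hiding Site Plane Plaq Bond
open T4AveragingDeficitWallBoundary (periodBox)
open Summit.QuantumFields.BalabanUV.T4Continuum
open AveragingDeficitPeriodicCounting (IsPeriodicDir)
open MinimalActionSandwich (IsMinimiser)
open MinimalActionRate (Regular sfClass)
open NE3EnergyShapes (residualScale residualScale_nonneg IsUnitarySite IsPeriodicSite)
open NE3EnergyWeightedShapes (energyNormW NE3EnergyRateW)
open NE3EnergyWeightedCovShape (NE3EnergyRateWCov ne3EnergyRateW_of_cov)
open Literature.MathematicalPhysics.QuantumFieldTheory.Balaban1983to89.T4Continuum (T4Family ULoop)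
open YMDAG.UVSplit (NE3Carriers RateCarriers RateRecordPred Datum N16At S_N16)

noncomputable section

variable {d : ℕ} {n : Type*} [Fintype n] [DecidableEq n]

/-! ## §1 The covariant root with (Lip₂′ᶜ) at exponent `β` -/

variable (d) in
/-- **T-E_w^cov AT HÖLDER EXPONENT `β` — THE β-ROOT** (a `Prop`; asserted for no class here): VERBATIM `NE3EnergyWeightedCovShape.NE3EnergyRateWCov d 𝒞 L N b g C Λ₁ Λ₂' dom`
— for every level `k ≥ 1`, datum `V ∈ dom` and minimiser pair `(U_A, U_B)` with `U_B` regular: `∃ (u, Z)` unitary∕periodic, skew∕periodic, `gaugeAct u U_A =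
vary W Z 1` (`W := rescale L (bavg L U_B)`), the η-weighted energy bound `≤ C·residualScale`, (Lip₁ᶜ) `≤ Λ₁·ξ²` — EXCEPT that the third covariant conjunct (Lip₂′ᶜ)
reads `‖Ad (W (y+e κ) μ) (Ad (W (y+e κ+e μ) μ) (Z (y+2•e μ) κ) − Z (y+e μ) κ) − (Ad (W (y+e κ) μ) (Z (y+e μ) κ) − Z y κ)‖ ≤ Λ₂′·ξ^{(2:ℝ)+β}` (`ξ := ((L:ℝ)⁻¹)^k`,
real power) instead of `≤ Λ₂′·ξ^3`: the nearest-neighbour reading of [Balaban1985RegularSpaces] (1.36) third clause «‖A‖_{1,β} < B₂(β₀)(α₀+α₁)(Lʲη)^{−2−β},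
β ≦ β₀ < 1» (p. 82) at the pair.  `β = 1` is the root of record (§2).  The inline hypothesis `h` of `N16HolderWindow.closeness_of_covRoot_holder` and the inline
conclusions of `N16HolderEnd*` are this `Prop` unfolded. A hypothesis∕target SHAPE.
[cite: Balaban1985RegularSpaces, (1.36) p.82, p.83] -/
@[folklore]
def CovRootHolder (𝒞 : ℕ → Set (Site d → Fin d → (Matrix n n ℂ)ˣ)) (L N : ℕ) (b g C Λ₁ Λ₂' β : ℝ)
    (dom : Set (Site d → Fin d → (Matrix n n ℂ)ˣ)) : Prop :=
  ∀ k : ℕ, 1 ≤ k → ∀ V ∈ dom, ∀ UA UB : Site d → Fin d → (Matrix n n ℂ)ˣ,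
    IsMinimiser d 𝒞 L N k V UA → IsMinimiser d 𝒞 L N (k + 1) V UB → Regular d L N b g (k + 1) UB →
      ∃ (u : Site d → (Matrix n n ℂ)ˣ) (Z : Site d → Fin d → Matrix n n ℂ),
        IsUnitarySite u ∧ IsPeriodicSite u ((N * L ^ k : ℕ) : ℤ) ∧
        IsSkewDir Z ∧ IsPeriodicDir Z ((N * L ^ k : ℕ) : ℤ) ∧
        gaugeAct u UA = vary (rescale L (bavg L UB)) Z 1 ∧
        energyNormW L k (rescale L (bavg L UB)) Z (periodBox (N * L ^ k)) ≤ C * residualScale d L N b g k ∧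
        (∀ (κ : Fin d) (x : Site d) (μ : Fin d),
          ‖Ad (rescale L (bavg L UB) (x + e κ) μ) (Z (x + e μ) κ) - Z x κ‖ ≤ Λ₁ * (((L : ℝ)⁻¹) ^ k) ^ 2) ∧
        (∀ (κ μ : Fin d) (y : Site d),
          ‖Ad (rescale L (bavg L UB) (y + e κ) μ)
              (Ad (rescale L (bavg L UB) (y + e κ + e μ) μ) (Z (y + (2 : ℕ) • e μ) κ) - Z (y + e μ) κ)
            - (Ad (rescale L (bavg L UB) (y + e κ) μ) (Z (y + e μ) κ) - Z y κ)‖ ≤ Λ₂' * (((L : ℝ)⁻¹) ^ k) ^ ((2 : ℝ) + β))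

/-- `CovRootHolder` unfolded (`Iff.rfl`). [folklore] -/
theorem covRootHolder_iff {𝒞 : ℕ → Set (Site d → Fin d → (Matrix n n ℂ)ˣ)} {L N : ℕ} {b g C Λ₁ Λ₂' β : ℝ}
    {dom : Set (Site d → Fin d → (Matrix n n ℂ)ˣ)} :
    CovRootHolder d 𝒞 L N b g C Λ₁ Λ₂' β dom ↔
      ∀ k : ℕ, 1 ≤ k → ∀ V ∈ dom, ∀ UA UB : Site d → Fin d → (Matrix n n ℂ)ˣ,
        IsMinimiser d 𝒞 L N k V UA → IsMinimiser d 𝒞 L N (k + 1) V UB → Regular d L N b g (k + 1) UB →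
          ∃ (u : Site d → (Matrix n n ℂ)ˣ) (Z : Site d → Fin d → Matrix n n ℂ),
            IsUnitarySite u ∧ IsPeriodicSite u ((N * L ^ k : ℕ) : ℤ) ∧
            IsSkewDir Z ∧ IsPeriodicDir Z ((N * L ^ k : ℕ) : ℤ) ∧
            gaugeAct u UA = vary (rescale L (bavg L UB)) Z 1 ∧
            energyNormW L k (rescale L (bavg L UB)) Z (periodBox (N * L ^ k)) ≤ C * residualScale d L N b g k ∧
            (∀ (κ : Fin d) (x : Site d) (μ : Fin d),
              ‖Ad (rescale L (bavg L UB) (x + e κ) μ) (Z (x + e μ) κ) - Z x κ‖ ≤ Λ₁ * (((L : ℝ)⁻¹) ^ k) ^ 2) ∧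
            (∀ (κ μ : Fin d) (y : Site d),
              ‖Ad (rescale L (bavg L UB) (y + e κ) μ)
                  (Ad (rescale L (bavg L UB) (y + e κ + e μ) μ) (Z (y + (2 : ℕ) • e μ) κ) - Z (y + e μ) κ)
                - (Ad (rescale L (bavg L UB) (y + e κ) μ) (Z (y + e μ) κ) - Z y κ)‖ ≤ Λ₂' * (((L : ℝ)⁻¹) ^ k) ^ ((2 : ℝ) + β)) :=
  Iff.rfl

/-- The per-pair body of the β-root (for consumers that destructure one level ∕ datum ∕ minimiser pair). [folklore] -/
theorem CovRootHolder.perPair {𝒞 : ℕ → Set (Site d → Fin d → (Matrix n n ℂ)ˣ)} {L N : ℕ} {b g C Λ₁ Λ₂' β : ℝ}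
    {dom : Set (Site d → Fin d → (Matrix n n ℂ)ˣ)} (h : CovRootHolder d 𝒞 L N b g C Λ₁ Λ₂' β dom)
    {k : ℕ} (hk : 1 ≤ k) {V : Site d → Fin d → (Matrix n n ℂ)ˣ} (hV : V ∈ dom) {UA UB : Site d → Fin d → (Matrix n n ℂ)ˣ}
    (hA : IsMinimiser d 𝒞 L N k V UA) (hB : IsMinimiser d 𝒞 L N (k + 1) V UB) (hreg : Regular d L N b g (k + 1) UB) :
    ∃ (u : Site d → (Matrix n n ℂ)ˣ) (Z : Site d → Fin d → Matrix n n ℂ),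
      IsUnitarySite u ∧ IsPeriodicSite u ((N * L ^ k : ℕ) : ℤ) ∧
      IsSkewDir Z ∧ IsPeriodicDir Z ((N * L ^ k : ℕ) : ℤ) ∧
      gaugeAct u UA = vary (rescale L (bavg L UB)) Z 1 ∧
      energyNormW L k (rescale L (bavg L UB)) Z (periodBox (N * L ^ k)) ≤ C * residualScale d L N b g k ∧
      (∀ (κ : Fin d) (x : Site d) (μ : Fin d),
        ‖Ad (rescale L (bavg L UB) (x + e κ) μ) (Z (x + e μ) κ) - Z x κ‖ ≤ Λ₁ * (((L : ℝ)⁻¹) ^ k) ^ 2) ∧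
      (∀ (κ μ : Fin d) (y : Site d),
        ‖Ad (rescale L (bavg L UB) (y + e κ) μ)
            (Ad (rescale L (bavg L UB) (y + e κ + e μ) μ) (Z (y + (2 : ℕ) • e μ) κ) - Z (y + e μ) κ)
          - (Ad (rescale L (bavg L UB) (y + e κ) μ) (Z (y + e μ) κ) - Z y κ)‖ ≤ Λ₂' * (((L : ℝ)⁻¹) ^ k) ^ ((2 : ℝ) + β)) :=
  h k hk V hV UA UB hA hB hreg

/-- The β-root is monotone in the three constants `C ≤ C′`, `Λ₁ ≤ Λ₁′`, `Λ₂′ ≤ Λ₂″` (the residual scale, `ξ²` and the real power `ξ^{2+β}` are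
non-negative). [folklore] -/
theorem CovRootHolder.mono {𝒞 : ℕ → Set (Site d → Fin d → (Matrix n n ℂ)ˣ)} {L N : ℕ} {b g C C' Λ₁ Λ₁' Λ₂' Λ₂'' β : ℝ}
    {dom : Set (Site d → Fin d → (Matrix n n ℂ)ˣ)} (h : CovRootHolder d 𝒞 L N b g C Λ₁ Λ₂' β dom) (hC : C ≤ C') (hΛ₁ : Λ₁ ≤ Λ₁')
    (hΛ₂ : Λ₂' ≤ Λ₂'') : CovRootHolder d 𝒞 L N b g C' Λ₁' Λ₂'' β dom := by
  intro k hk V hV UA UB hA hB hreg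
  obtain ⟨u, Z, hu, huP, hZ, hZP, hrep, hE, h1, h2⟩ := h k hk V hV UA UB hA hB hreg
  have hξ : 0 ≤ ((L : ℝ)⁻¹) ^ k := pow_nonneg (inv_nonneg.mpr (Nat.cast_nonneg L)) k
  refine ⟨u, Z, hu, huP, hZ, hZP, hrep, hE.trans ?_, fun κ x μ => (h1 κ x μ).trans ?_, fun κ μ y => (h2 κ μ y).trans ?_⟩
  · exact mul_le_mul_of_nonneg_right hC (residualScale_nonneg d L N b g k)
  · exact mul_le_mul_of_nonneg_right hΛ₁ (pow_nonneg hξ 2)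
  · exact mul_le_mul_of_nonneg_right hΛ₂ (Real.rpow_nonneg hξ _)

/-- `ξ^{2+β} ≤ ξ^{2+β′}` for `ξ = (L⁻¹)^k`, `L ≥ 1`, `β′ ≤ β` (`0 < ξ ≤ 1`). [folklore] -/
theorem xi_rpow_le_rpow_of_le {L : ℕ} (hL : 1 ≤ L) {β β' : ℝ} (hβ : β' ≤ β) (k : ℕ) :
    (((L : ℝ)⁻¹) ^ k) ^ ((2 : ℝ) + β) ≤ (((L : ℝ)⁻¹) ^ k) ^ ((2 : ℝ) + β') := by
  have hL1 : (1 : ℝ) ≤ (L : ℝ) := by exact_mod_cast hL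
  have hξ0 : 0 < ((L : ℝ)⁻¹) ^ k := pow_pos (inv_pos.mpr (by linarith)) k
  have hξ1 : ((L : ℝ)⁻¹) ^ k ≤ 1 := pow_le_one₀ (inv_nonneg.mpr (by linarith)) (inv_le_one_of_one_le₀ hL1)
  exact Real.rpow_le_rpow_of_exponent_ge hξ0 hξ1 (by linarith)

/-- **THE β-ROOT IS ANTITONE IN THE EXPONENT**: for `L ≥ 1`, `0 ≤ Λ₂′` and `β′ ≤ β` the β-root implies the β′-root (`ξ^{2+β} ≤ ξ^{2+β′}` on `ξ ∈ (0,1]`).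
So a supplier at any printed `β₀` serves every smaller exponent, and the root of record (`β = 1`, §2) serves them all. [folklore] -/
theorem CovRootHolder.of_exponent_le {𝒞 : ℕ → Set (Site d → Fin d → (Matrix n n ℂ)ˣ)} {L N : ℕ} (hL : 1 ≤ L) {b g C Λ₁ Λ₂' β β' : ℝ}
    (hΛ₂' : 0 ≤ Λ₂') (hβ : β' ≤ β) {dom : Set (Site d → Fin d → (Matrix n n ℂ)ˣ)} (h : CovRootHolder d 𝒞 L N b g C Λ₁ Λ₂' β dom) :
    CovRootHolder d 𝒞 L N b g C Λ₁ Λ₂' β' dom := by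
  intro k hk V hV UA UB hA hB hreg
  obtain ⟨u, Z, hu, huP, hZ, hZP, hrep, hE, h1, h2⟩ := h k hk V hV UA UB hA hB hreg
  refine ⟨u, Z, hu, huP, hZ, hZP, hrep, hE, h1, fun κ μ y => (h2 κ μ y).trans ?_⟩
  exact mul_le_mul_of_nonneg_left (xi_rpow_le_rpow_of_le hL hβ k) hΛ₂'

/-- **β-ROOT ⇒ T-E_w**: dropping the two covariant conjuncts recovers `NE3EnergyWeightedShapes.NE3EnergyRateW` (NE3 proper) verbatim. [folklore] -/
theorem ne3EnergyRateW_of_covRootHolder {𝒞 : ℕ → Set (Site d → Fin d → (Matrix n n ℂ)ˣ)} {L N : ℕ} {b g C Λ₁ Λ₂' β : ℝ}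
    {dom : Set (Site d → Fin d → (Matrix n n ℂ)ˣ)} (h : CovRootHolder d 𝒞 L N b g C Λ₁ Λ₂' β dom) :
    NE3EnergyRateW d 𝒞 L N b g C dom := by
  intro k hk V hV UA UB hA hB hreg
  obtain ⟨u, Z, hu, huP, hZ, hZP, hrep, hE, -, -⟩ := h k hk V hV UA UB hA hB hreg
  exact ⟨u, Z, hu, huP, hZ, hZP, hrep, hE⟩

/-! ## §2 `β = 1` IS the root of record; the root of record implies every β-root with `β ≤ 1` -/

/-- `ξ^{(2:ℝ)+1} = ξ^3` (real power versus monoid power) for `ξ = (L⁻¹)^k`. [folklore] -/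
theorem xi_rpow_two_add_one (L k : ℕ) : (((L : ℝ)⁻¹) ^ k) ^ ((2 : ℝ) + 1) = (((L : ℝ)⁻¹) ^ k) ^ 3 := by
  rw [show (2 : ℝ) + 1 = ((3 : ℕ) : ℝ) by norm_num, Real.rpow_natCast]

/-- **AT `β = 1` THE β-ROOT IS THE ROOT OF RECORD, LITERALLY**: `CovRootHolder d 𝒞 L N b g C Λ₁ Λ₂' 1 dom ↔ NE3EnergyRateWCov d 𝒞 L N b g C Λ₁ Λ₂' dom`
(`ξ^{(2:ℝ)+1} = ξ^3`; every other token identical).  So each `1 ↦ β` twin of the N16 producer column RETURNS its theorem of record at `β := 1`. [folklore] -/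
theorem covRootHolder_one_iff {𝒞 : ℕ → Set (Site d → Fin d → (Matrix n n ℂ)ˣ)} {L N : ℕ} {b g C Λ₁ Λ₂' : ℝ}
    {dom : Set (Site d → Fin d → (Matrix n n ℂ)ˣ)} :
    CovRootHolder d 𝒞 L N b g C Λ₁ Λ₂' 1 dom ↔ NE3EnergyRateWCov d 𝒞 L N b g C Λ₁ Λ₂' dom := by
  unfold CovRootHolder NE3EnergyRateWCov
  simp only [xi_rpow_two_add_one]

/-- **THE ROOT OF RECORD IMPLIES THE β-ROOT** (any `d`, `L ≥ 1`, `β ≤ 1`, `Λ₂′ ≥ 0`) — `N16HolderWindow.covRoot_holder_of_ne3EnergyRateWCov` concluding by name: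
`ξ^3 ≤ ξ^{2+β}` on `ξ ∈ (0, 1]`.  The located repair R-β is a WEAKENING of the root of record. [folklore] -/
theorem covRootHolder_of_ne3EnergyRateWCov {𝒞 : ℕ → Set (Site d → Fin d → (Matrix n n ℂ)ˣ)} {L N : ℕ} (hL : 1 ≤ L) {b g C Λ₁ Λ₂' β : ℝ}
    (hβ : β ≤ 1) (hΛ₂' : 0 ≤ Λ₂') {dom : Set (Site d → Fin d → (Matrix n n ℂ)ˣ)} (h : NE3EnergyRateWCov d 𝒞 L N b g C Λ₁ Λ₂' dom) :
    CovRootHolder d 𝒞 L N b g C Λ₁ Λ₂' β dom :=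
  (covRootHolder_one_iff.mpr h).of_exponent_le hL hΛ₂' hβ

/-- … and at `β = 1` back: the β-root at exponent `1` IS the root of record (no sign condition). [folklore] -/
theorem ne3EnergyRateWCov_of_covRootHolder_one {𝒞 : ℕ → Set (Site d → Fin d → (Matrix n n ℂ)ˣ)} {L N : ℕ} {b g C Λ₁ Λ₂' : ℝ}
    {dom : Set (Site d → Fin d → (Matrix n n ℂ)ˣ)} (h : CovRootHolder d 𝒞 L N b g C Λ₁ Λ₂' 1 dom) :
    NE3EnergyRateWCov d 𝒞 L N b g C Λ₁ Λ₂' dom :=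
  covRootHolder_one_iff.mp h

/-! ## §3 The β-analogues of the venue decl `N16At` and of the stub `S_N16` (CANDIDATE wordings; nothing of record edited) -/

/-- **N16 · NE3 ON ITS CARRIERS WITH (Lip₂′ᶜ) AT EXPONENT `β`** — the β-analogue of the venue decl `YMDAG.UVSplit.N16At c` (SpineRates §7.2):
`CovRootHolder 4 (sfClass 4 c.L c.Nper c.ε) c.L c.Nper c.b c.g c.C c.Λ₁ c.Λ₂' β c.dom` at colour `Fin N`.  `N16HolderAt c 1 ↔ N16At c` (below).  A CANDIDATE
wording for the located repair R-β (statement edits are the planner's; `N16At` is untouched); a hypothesis∕target SHAPE asserted for no bundle. [folklore] -/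
@[folklore]
def N16HolderAt {N : ℕ} (c : NE3Carriers N) (β : ℝ) : Prop :=
  CovRootHolder 4 (sfClass 4 c.L c.Nper c.ε) c.L c.Nper c.b c.g c.C c.Λ₁ c.Λ₂' β c.dom

/-- `N16HolderAt c β` unfolded one step (`Iff.rfl`). [folklore] -/
theorem n16HolderAt_iff {N : ℕ} (c : NE3Carriers N) (β : ℝ) :
    N16HolderAt c β ↔ CovRootHolder 4 (sfClass 4 c.L c.Nper c.ε) c.L c.Nper c.b c.g c.C c.Λ₁ c.Λ₂' β c.dom :=
  Iff.rfl

/-- **AT `β = 1` THE CANDIDATE IS THE VENUE DECL**: `N16HolderAt c 1 ↔ N16At c`. [folklore] -/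
theorem n16HolderAt_one_iff {N : ℕ} (c : NE3Carriers N) : N16HolderAt c 1 ↔ N16At c :=
  covRootHolder_one_iff

/-- **`N16At c` IMPLIES `N16HolderAt c β` FOR EVERY `β ≤ 1`** (`c.L ≥ 1`, `c.Λ₂′ ≥ 0`) — R-β asks less of node N05's socket than the decl of record. [folklore] -/
theorem n16HolderAt_of_n16At {N : ℕ} {c : NE3Carriers N} (h : N16At c) (hL : 1 ≤ c.L) {β : ℝ} (hβ : β ≤ 1) (hΛ : 0 ≤ c.Λ₂') :
    N16HolderAt c β :=
  covRootHolder_of_ne3EnergyRateWCov hL hβ hΛ h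

section Stub

variable {N : ℕ} [NeZero N]

/-- **N16 · NE3 AT EXPONENT `β` BY NAME AT THE CARRIERS OF RECORD** — the β-analogue of the stub `YMDAG.UVSplit.S_N16 RRec`: for every family, datum, tuned
bare sequence, loop string and rate-carrier bundle OF RECORD, `N16HolderAt R.ne3 β`.  `S_N16Holder 1 RRec ↔ S_N16 RRec` (below).  A CANDIDATE wording; the
stub of record is untouched. [folklore] -/
@[folklore]
def S_N16Holder (β : ℝ) (RRec : RateRecordPred N) : Prop :=
  ∀ (F : T4Family) (D : Datum F N) (g₀ : ℕ → ℝ) (os : List (ULoop F)) (R : RateCarriers N), RRec F D g₀ os R → N16HolderAt R.ne3 β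

/-- `S_N16Holder β RRec` unfolded (`Iff.rfl`). [folklore] -/
theorem s_N16Holder_iff (β : ℝ) (RRec : RateRecordPred N) :
    S_N16Holder β RRec ↔
      ∀ (F : T4Family) (D : Datum F N) (g₀ : ℕ → ℝ) (os : List (ULoop F)) (R : RateCarriers N), RRec F D g₀ os R → N16HolderAt R.ne3 β :=
  Iff.rfl

/-- **AT `β = 1` THE CANDIDATE STUB IS THE STUB OF RECORD**: `S_N16Holder 1 RRec ↔ S_N16 RRec`. [folklore] -/
theorem s_N16Holder_one_iff (RRec : RateRecordPred N) : S_N16Holder 1 RRec ↔ S_N16 RRec := by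
  unfold S_N16Holder S_N16
  simp only [n16HolderAt_one_iff]

/-- **`S_N16 RRec` IMPLIES `S_N16Holder β RRec` FOR EVERY `β ≤ 1`**, provided the record's bundles have block factor `≥ 1` and a non-negative Hölder letter
`Λ₂′` (both hold in THE END's regime of record, `N16Regime.InEndRegime`: `2 ≤ c.L`; the letter placed above a non-negative sum). [folklore] -/
theorem s_N16Holder_of_s_N16 {RRec : RateRecordPred N} (h : S_N16 RRec) {β : ℝ} (hβ : β ≤ 1)
    (hreg : ∀ (F : T4Family) (D : Datum F N) (g₀ : ℕ → ℝ) (os : List (ULoop F)) (R : RateCarriers N), RRec F D g₀ os R →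
      1 ≤ R.ne3.L ∧ 0 ≤ R.ne3.Λ₂') :
    S_N16Holder β RRec :=
  fun F D g₀ os R hR => n16HolderAt_of_n16At (h F D g₀ os R hR) (hreg F D g₀ os R hR).1 hβ (hreg F D g₀ os R hR).2

end Stub

end

end Summit.QuantumFields.YangMills.BalabanUVNodes.N16HolderDefs
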